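import Literature.NumberTheory.Automorphic.HyperspecialUnitarySatakeCountingImage
import Literature.NumberTheory.Automorphic.SplitOrthogonalSatakeWeylInvariance
import HarnessLib

/-!
# The COUNTING Satake transform of the split orthogonal group `O_N(J₀) = U(id, J₀)`: over EVERY commutative ring `R`,
# `𝒮_1 : ℋ(O_N(J₀), K₀; R) ⥲ 𝒯^{O}_R`, the twisted Weyl invariants `f_{μ∘π} = q^{(Λ(μ∘π)-Λ(μ))/2} f_μ`
# (Treumann–Venkatesh 2016 §7.2 Thm. (i) — the square-root-free form; Henniart–Vignéras 2015 §7.13–§7.15; Satake 1963 §§8–9)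

Topic `NumberTheory/Automorphic`; namespace `Literature.NumberTheory.Automorphic.HermitianLattice[.UnramifiedLocalConjDatum]`
(lane `lit-hodgefound`, Track 2 foundations; seat `lit-hodgefound-p11`, generation 49, row g49-#9).  Three DEFINITIONS with bodies
(`orthogonalTwistExp μ = ⟨ν,μ⟩ - hs(μ)`, the orthogonal exponent `Λ`; `orthogonalTwistedSatakeTarget R N q`, an `R`-submodule of
`R[ℤ^N]`; `countingSatakeLinearEquivOrthogonal`) + theorems; no named fact, no instance, no notation.  The `σ = id` companion of
g49-#6 `HyperspecialUnitarySatakeCountingImage` (`U(σ, J₀)`, `σ ≠ id`, base `q_F = √q`, exponent `⟨ν,·⟩`): here the base is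
`q = #𝓀` itself and the exponent is HALF the difference of the orthogonal exponents `Λ = ⟨ν,·⟩ - hs` (`δ_B^{1/2} = q^{-Λ/2}… ` on
cocharacters, `u^{-Λ}` with `u² = q`), Treumann–Venkatesh's `q_v^{⟨Σ^*-wΣ^*, χ⟩/2}` («`Σ^*/wΣ^*` is divisible by `2` in that
cocharacter lattice; thus `√(Σ^*/wΣ^*)(q_v)` makes sense» — the case that MOTIVATES their square-root-free formulation, since for
`O_{2m+1}` the half-sum of positive roots is not a character).

## The mathematics

`G = O_N(J₀) = U(id, J₀^{(N)})` over a non-archimedean local field `K` (finite residue field with `q` elements, uniformizer `ϖ`,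
datum `hd : UnramifiedLocalConjDatum (RingHom.id K) ϖ`), `K₀ = O_N(J₀)(𝒪)`, `a(γ) ∈ ℤ^N` the Iwasawa exponents, `W = C_{S_N}(rev)`,
`Λ(μ) = ⟨ν, μ⟩ - hs(μ)` (`= ∑_{i<j, i<j'} (μ_i - μ_j)` on antisymmetric `μ`, g49-#2 `orthogonalExp_eq_satakeTwistExp_sub_headSum`).
The counting transform `𝒮_1(T) = ∑_μ #{γ ∈ T : a(γ) = μ} x^μ` is injective over every `R` (g43), and for a unit `u` with
`u² = q` the normalised transform `𝒮_{u^{-Λ}}` is `W`-invariant (g49-#2 `coeff_satakeTransform_comp_perm_of_units_orthogonal'`).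
THEOREM: **for every commutative ring `R`, `𝒮_1` maps `ℋ(O_N(J₀), K₀; R)` isomorphically onto**

  `𝒯^{O}_R = {f ∈ R[ℤ^N] : supp f ⊆ {antisymmetric}, f_{μ∘π} = q^{⌊(Λ(μ∘π)-Λ(μ))/2⌋} f_μ for all π ∈ W, μ with Λ(μ) ≤ Λ(μ∘π)}`

(`orthogonalTwistedSatakeTarget R N q`).  The exponent `Λ(μ∘π) - Λ(μ)` is in fact always EVEN (Treumann–Venkatesh, loc. cit.),
so `⌊·/2⌋` is exact; the proof below does not use this: it derives the counting identity
`n_g(μ∘π) = q^{⌊(Λ(μ∘π)-Λ(μ))/2⌋} n_g(μ)` (§3) from the `W`-invariance over `ℂ` for BOTH square roots `±√q`, which forces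
`n_g(μ∘π) = n_g(μ) = 0` whenever the exponent would be odd.  (⊇) is Cartier's triangular induction from the ANTIDOMINANT end exactly
as in g49-#6, the stability of `supp f` under the `Λ`-non-increasing `W`-moves again making the head-sum-lexicographic minimum of the
support antidominant (`monotone_of_isMinOn_headSumVec_of_moves`, the move form of g49-#6's lemma: only the pair swaps
`(j j')(rev j, rev j')` and the flip `(k, rev k)` are used, and both lower `Λ` as well as `⟨ν,·⟩`).

## What is formalised

* §1 `headSum_comp_swapPairs`, `headSum_comp_flipPair`, `orthogonalTwistExp` (+ `_add`, `_eq_sum_pairs`),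
  `orthogonalTwistExp_comp_swapPairs_le`, `orthogonalTwistExp_comp_flipPair_le`, **`monotone_of_isMinOn_headSumVec_of_moves`**,
  `monotone_of_isMinOn_headSumVec_orthogonal`.
* §2 `orthogonalTwistedSatakeTarget R N q` (+ `mem_…_iff`, `coeff_ne_zero_comp_of_mem_orthogonalTwisted`).
* §3 **`card_filter_iwasawaExp_comp_perm_eq_orthogonal`** (`n_g(μ∘π) = q^{⌊(Λ(μ∘π)-Λ(μ))/2⌋} n_g(μ)` in `ℕ`, via `±√q ∈ ℂ`).
* §4 **`satakeTransform_one_mem_orthogonalTwistedSatakeTarget`** (`⊆`).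
* §5 **`exists_satakeTransform_one_eq_of_mem_orthogonalTwisted`** (`⊇`), **`range_satakeTransform_one_eq_orthogonalTwistedSatakeTarget`**,
  `toSubmodule_range_satakeTransform_one_eq_orthogonalTwistedSatakeTarget`, `mul_mem_orthogonalTwistedSatakeTarget`,
  **`countingSatakeLinearEquivOrthogonal : ℋ(O_N(J₀), K₀; R) ≃ₗ[R] 𝒯^{O}_R`** (+ `_apply`).

## References
* [TreumannVenkatesh2016] D. Treumann, A. Venkatesh, *Functoriality, Smith theory, and the Brauer homomorphism*, Ann. of Math. 183
  (2016), §7.2 (twisted action, Thm. (i), proof via `𝒮^* = δ^{-1/2}𝒮`).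
* [HenniartVigneras2013] G. Henniart, M.-F. Vignéras, *A Satake isomorphism for representations modulo p of reductive groups over
  local fields*, J. reine angew. Math. 701 (2015), §7.12 Lemma 2, §7.13–§7.15.
* [Satake1963] I. Satake, *Theory of spherical functions on reductive algebraic groups over 𝔭-adic fields*, Publ. Math. IHÉS 18
  (1963), §§8–9.
* [CartierCorvallis1979] P. Cartier, *Representations of 𝔭-adic groups: a survey*, PSPM 33.1 (1979), §IV (4.2), Thm. 4.1.
* [BruhatTits1972] F. Bruhat, J. Tits, *Groupes réductifs sur un corps local I*, Publ. Math. IHÉS 41 (1972), (4.4.3), (4.4.4).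
-/

noncomputable section

open scoped Valued WithZero Matrix MatrixGroups
open MonoidAlgebra Representation

namespace Literature.NumberTheory.Automorphic.HermitianLattice

open Literature.NumberTheory.Automorphic Literature.NumberTheory.Automorphic.CartanUnique
  Literature.NumberTheory.Automorphic.SymplecticCartan

variable {R : Type*} [CommRing R] {N : ℕ}

/-! ## §1 The orthogonal exponent `Λ = ⟨ν,·⟩ - hs` and the `W`-moves -/

section Moves

/-- A pair swap `(j j')(rev j, rev j')` inside the first block does not change the head sum `hs = ∑_{i<N/2}`.
[cite: BruhatTits1972, (4.4.3)] -/
theorem headSum_comp_swapPairs (a : Fin N → ℤ) {j j' : Fin N} (hjj' : j ≠ j') (hj : (j : ℕ) < N / 2) (hj' : (j' : ℕ) < N / 2) :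
    headSum (a ∘ ⇑(swapPairs j j')) (N / 2) = headSum a (N / 2) := by
  refine headSum_comp_perm_of_iff a fun i => ?_
  have hjv := j.isLt; have hj'v := j'.isLt; have hiv := i.isLt
  rw [swapPairs_val hjj' hj hj']
  split_ifs <;> omega

/-- The flip `(k, rev k)`, `k < N/2`, changes the head sum by `a_{rev k} - a_k`. [cite: BruhatTits1972, (4.4.3)] -/
theorem headSum_comp_flipPair (a : Fin N → ℤ) {k : Fin N} (hk : (k : ℕ) < N / 2) :
    headSum (a ∘ ⇑(flipPair k)) (N / 2) = headSum a (N / 2) - a k + a (Fin.rev k) := by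
  have hkv := k.isLt
  have hrk : ¬ ((Fin.rev k : Fin N) : ℕ) < N / 2 := by rw [Fin.val_rev]; omega
  have hne : Fin.rev k ≠ k := fun h => hrk (by rw [h]; exact hk)
  rw [headSum_eq, headSum_eq]
  have h1 : ∀ i : Fin N, (if (i : ℕ) < N / 2 then (a ∘ ⇑(flipPair k)) i else 0) =
      (if (i : ℕ) < N / 2 then a i else 0) + (if i = k then a (Fin.rev k) - a k else 0) := by
    intro i
    by_cases hik : i = k
    · rw [hik, if_pos hk, if_pos hk, if_pos rfl, Function.comp_apply, flipPair_apply_self]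
      ring
    · by_cases hik' : i = Fin.rev k
      · rw [hik', if_neg hrk, if_neg hrk, if_neg hne, add_zero]
      · rw [Function.comp_apply, flipPair_apply_of_ne hik hik', if_neg hik, add_zero]
  rw [Finset.sum_congr rfl fun i _ => h1 i, Finset.sum_add_distrib, Finset.sum_ite_eq' Finset.univ k, if_pos (Finset.mem_univ _)]
  ring

/-- **The orthogonal exponent `Λ(μ) = ⟨ν, μ⟩ - hs(μ)`** (`= ∑_{i<j, i<j'} (μ_i - μ_j) = ⟨μ, 2ρ_{O_N}⟩`-type pairing on the
antisymmetric lattice; the orthogonally normalised weight is `u^{-Λ}`, `u² = q`). [cite: CartierCorvallis1979, §IV (4.2)]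
[cite: Satake1963, §§8–9] -/
def orthogonalTwistExp (μ : Fin N → ℤ) : ℤ := satakeTwistExp μ - headSum μ (N / 2)

/-- Unfolding `Λ`. [cite: CartierCorvallis1979, §IV (4.2)] -/
theorem orthogonalTwistExp_eq (μ : Fin N → ℤ) : orthogonalTwistExp μ = satakeTwistExp μ - headSum μ (N / 2) := rfl

/-- `Λ` is additive. [cite: CartierCorvallis1979, §IV (4.2)] -/
theorem orthogonalTwistExp_add (μ ν : Fin N → ℤ) : orthogonalTwistExp (μ + ν) = orthogonalTwistExp μ + orthogonalTwistExp ν := by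
  rw [orthogonalTwistExp, orthogonalTwistExp, orthogonalTwistExp, satakeTwistExp_add, headSum_add]
  ring

/-- On antisymmetric `μ`, `Λ(μ) = ∑_{i<j, i<j'} (μ_i - μ_j)`, the exponent of the orthogonal weight of g49-#2.
[cite: CartierCorvallis1979, §IV (4.2)] [cite: Satake1963, §§8–9] -/
theorem orthogonalTwistExp_eq_sum_pairs {μ : Fin N → ℤ} (hμ : ∀ i, μ (Fin.rev i) = -μ i) :
    orthogonalTwistExp μ = ∑ p ∈ (Finset.univ : Finset (Fin N × Fin N)) with (p.1 < p.2 ∧ p.1 < Fin.rev p.2), (μ p.1 - μ p.2) := by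
  rw [orthogonalTwistExp, orthogonalExp_eq_satakeTwistExp_sub_headSum hμ]

/-- A pair swap correcting an inversion `a_{j'} < a_j`, `j < j' < N/2`, of an antisymmetric `a` LOWERS `Λ` (it lowers `⟨ν,·⟩` and
fixes `hs`). [cite: BruhatTits1972, (4.4.3)] -/
theorem orthogonalTwistExp_comp_swapPairs_le {a : Fin N → ℤ} (ha : ∀ i, a (Fin.rev i) = -a i) {j j' : Fin N}
    (hjj' : (j : ℕ) < (j' : ℕ)) (hj' : (j' : ℕ) < N / 2) (hlt : a j' < a j) :
    orthogonalTwistExp (a ∘ ⇑(swapPairs j j')) ≤ orthogonalTwistExp a := by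
  have hne : j ≠ j' := fun h => by rw [h] at hjj'; exact lt_irrefl _ hjj'
  rw [orthogonalTwistExp, orthogonalTwistExp, headSum_comp_swapPairs a hne (lt_trans hjj' hj') hj']
  linarith [satakeTwistExp_comp_swapPairs_le ha hjj' hj' hlt]

/-- The flip `(k, rev k)`, `k < N/2`, applied to an antisymmetric `a` with `0 < a_k` does not increase `Λ`
(`Λ` drops by `2 a_k (N - 2 - 2k) ≥ 0`). [cite: BruhatTits1972, (4.4.3)] -/
theorem orthogonalTwistExp_comp_flipPair_le {a : Fin N → ℤ} (ha : ∀ i, a (Fin.rev i) = -a i) {k : Fin N} (hk : (k : ℕ) < N / 2)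
    (hpos : 0 < a k) : orthogonalTwistExp (a ∘ ⇑(flipPair k)) ≤ orthogonalTwistExp a := by
  have hkv := k.isLt
  rw [orthogonalTwistExp, orthogonalTwistExp, headSum_comp_flipPair a hk, flipPair, satakeTwistExp_comp_swap, ha, Fin.val_rev,
    Nat.cast_sub (by omega)]
  push_cast
  have h1 : (0 : ℤ) ≤ (N : ℤ) - 2 - 2 * ((k : ℕ) : ℤ) := by omega
  nlinarith [mul_nonneg h1 hpos.le]

/-- **A head-sum lexicographically MINIMAL element of a set of antisymmetric exponents stable under the two correcting moves is
antidominant (monotone)** — the move form of g49-#6 `monotone_of_isMinOn_headSumVec`: it suffices that `S` be stable under the pair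
swaps `(j j')(rev j, rev j')` correcting an inversion `μ_{j'} < μ_j`, `j < j' < N/2`, and under the flip `(k, rev k)` correcting
`μ_k > 0` at the end of the first block. [cite: CartierCorvallis1979, §IV, proof of Thm. 4.1] [cite: BruhatTits1972, (4.4.3), (4.4.4)] -/
theorem monotone_of_isMinOn_headSumVec_of_moves {S : Finset (Fin N → ℤ)}
    (hS₁ : ∀ μ ∈ S, ∀ j j' : Fin N, (j : ℕ) < (j' : ℕ) → (j' : ℕ) < N / 2 → μ j' < μ j → μ ∘ ⇑(swapPairs j j') ∈ S)
    (hS₂ : ∀ μ ∈ S, ∀ k : Fin N, (k : ℕ) + 1 = N / 2 → 0 < μ k → μ ∘ ⇑(flipPair k) ∈ S)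
    (hanti : ∀ μ ∈ S, ∀ i, μ (Fin.rev i) = -μ i) {a : Fin N → ℤ} (ha : a ∈ S)
    (hmin : ∀ b ∈ S, toLex (headSumVec a) ≤ toLex (headSumVec b)) : Monotone a := by
  have hanti_a := hanti a ha
  -- (i) `a` is monotone on the first block
  have step1 : ∀ j j' : Fin N, (j : ℕ) < (j' : ℕ) → (j' : ℕ) < N / 2 → a j ≤ a j' := by
    intro j j' hlt hj'
    have hj : (j : ℕ) < N / 2 := lt_trans hlt hj'
    have hjj' : j ≠ j' := fun h => by rw [h] at hlt; exact lt_irrefl _ hlt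
    by_contra hcon
    rw [not_le] at hcon
    have hb := hS₁ a ha j j' hlt hj' hcon
    refine absurd (hmin _ hb) (not_le.2 (toLex_headSumVec_lt j (fun r hr => ?_) ?_))
    · exact headSum_comp_eq_of_forall_lt a _ r fun i hi => swapPairs_apply_of_lt hjj' hj hj' (by omega) (by omega)
    · rw [headSum_succ, headSum_succ, headSum_comp_eq_of_forall_lt a _ _ fun i hi => swapPairs_apply_of_lt hjj' hj hj' hi
        (by omega), Function.comp_apply, swapPairs_apply_left hjj' hj hj']
      omega
  -- (ii) the last coordinate of the first block is `≤ 0`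
  have step2 : ∀ j : Fin N, (j : ℕ) + 1 = N / 2 → a j ≤ 0 := by
    intro j hj
    by_contra hcon
    rw [not_le] at hcon
    have hjv := j.isLt
    have hb := hS₂ a ha j hj hcon
    refine absurd (hmin _ hb) (not_le.2 (toLex_headSumVec_lt j (fun r hr => ?_) ?_))
    · refine headSum_comp_eq_of_forall_lt a _ r fun i hi => flipPair_apply_of_ne (fun h => ?_) (fun h => ?_)
      · rw [h] at hi; omega
      · rw [h, Fin.val_rev] at hi; omega
    · rw [headSum_succ, headSum_succ, headSum_comp_eq_of_forall_lt a _ _ fun i hi => flipPair_apply_of_ne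
        (fun h => by rw [h] at hi; omega) (fun h => by rw [h, Fin.val_rev] at hi; omega), Function.comp_apply,
        flipPair_apply_self, hanti_a]
      omega
  -- (iii) signs: `a ≤ 0` on the first block, `a ≥ 0` beyond it
  have hnonpos : ∀ i : Fin N, (i : ℕ) < N / 2 → a i ≤ 0 := by
    intro i hi
    have hl : a ⟨N / 2 - 1, by omega⟩ ≤ 0 := step2 _ (by simp only; omega)
    rcases eq_or_lt_of_le (Nat.le_sub_one_of_lt hi) with h | h
    · rw [show i = ⟨N / 2 - 1, by omega⟩ from Fin.ext h]; exact hl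
    · exact (step1 i ⟨N / 2 - 1, by omega⟩ h (by simp only; omega)).trans hl
  have hnonneg : ∀ i : Fin N, N / 2 ≤ (i : ℕ) → 0 ≤ a i := by
    intro i hi
    by_cases hmid : N ≤ (i : ℕ) + N / 2
    · have h := hnonpos (Fin.rev i) (by rw [Fin.val_rev]; have := i.isLt; omega)
      rw [hanti_a] at h
      omega
    · have hrev : Fin.rev i = i := Fin.ext (by rw [Fin.val_rev]; omega)
      have h := hanti_a i
      rw [hrev] at h
      omega
  -- (iv) conclusion
  intro i i' hii'
  rcases eq_or_lt_of_le hii' with h | h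
  · rw [h]
  by_cases hi' : (i' : ℕ) < N / 2
  · exact step1 i i' h hi'
  rw [not_lt] at hi'
  by_cases hi : (i : ℕ) < N / 2
  · exact (hnonpos i hi).trans (hnonneg i' hi')
  rw [not_lt] at hi
  by_cases hmid : N ≤ (i : ℕ) + N / 2
  · have h1 : ((Fin.rev i' : Fin N) : ℕ) < ((Fin.rev i : Fin N) : ℕ) := by rw [Fin.val_rev, Fin.val_rev]; omega
    have h2 : ((Fin.rev i : Fin N) : ℕ) < N / 2 := by rw [Fin.val_rev]; have := i.isLt; omega
    have h3 := step1 _ _ h1 h2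
    rw [hanti_a, hanti_a] at h3
    omega
  · have hrev : Fin.rev i = i := Fin.ext (by rw [Fin.val_rev]; omega)
    have h0 := hanti_a i
    rw [hrev] at h0
    have : a i = 0 := by omega
    rw [this]
    exact hnonneg i' hi'


/-- **Λ-form**: a head-sum lexicographically minimal element of a set of antisymmetric exponents stable under the
`Λ`-non-increasing `W`-moves is antidominant. [cite: CartierCorvallis1979, §IV, proof of Thm. 4.1] [cite: BruhatTits1972, (4.4.4)] -/
theorem monotone_of_isMinOn_headSumVec_orthogonal {S : Finset (Fin N → ℤ)}
    (hS : ∀ μ ∈ S, ∀ π : Equiv.Perm (Fin N), (∀ i, π (Fin.rev i) = Fin.rev (π i)) →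
      orthogonalTwistExp (μ ∘ π) ≤ orthogonalTwistExp μ → μ ∘ π ∈ S)
    (hanti : ∀ μ ∈ S, ∀ i, μ (Fin.rev i) = -μ i) {a : Fin N → ℤ} (ha : a ∈ S)
    (hmin : ∀ b ∈ S, toLex (headSumVec a) ≤ toLex (headSumVec b)) : Monotone a := by
  refine monotone_of_isMinOn_headSumVec_of_moves (fun μ hμ j j' hjj' hj' hlt => ?_) (fun μ hμ k hk hpos => ?_) hanti ha hmin
  · have hne : j ≠ j' := fun h => by rw [h] at hjj'; exact lt_irrefl _ hjj'
    exact hS μ hμ _ (swapPairs_rev hne (lt_trans hjj' hj') hj') (orthogonalTwistExp_comp_swapPairs_le (hanti μ hμ) hjj' hj' hlt)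
  · exact hS μ hμ _ (flipPair_rev k) (orthogonalTwistExp_comp_flipPair_le (hanti μ hμ) (by omega) hpos)

end Moves

/-! ## §2 The orthogonal twisted invariants `𝒯^{O}_R` -/

section Twisted

variable (R N) in
/-- **The orthogonal twisted Weyl invariants `𝒯^{O}_R(q) ⊆ R[ℤ^N]`**: `f` supported on the antisymmetric cocharacters with
`f_{μ∘π} = q^{⌊(Λ(μ∘π)-Λ(μ))/2⌋} f_μ` for every `π ∈ C_{S_N}(rev)` and every `μ` with `Λ(μ) ≤ Λ(μ∘π)` (the exponent difference is
even, [TreumannVenkatesh2016] §7.2: «`Σ^*/wΣ^*` is divisible by `2`»). [cite: TreumannVenkatesh2016, §7.2]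
[cite: HenniartVigneras2013, §7.12 Lemma 2, §7.13] -/
def orthogonalTwistedSatakeTarget (q : ℕ) : Submodule R (AddMonoidAlgebra R (Fin N → ℤ)) where
  carrier := {f | (∀ μ : Fin N → ℤ, (¬ ∀ i, μ (Fin.rev i) = -μ i) → f.coeff μ = 0) ∧
    ∀ π : Equiv.Perm (Fin N), (∀ i, π (Fin.rev i) = Fin.rev (π i)) → ∀ μ : Fin N → ℤ,
      orthogonalTwistExp μ ≤ orthogonalTwistExp (μ ∘ π) →
        f.coeff (μ ∘ π) = (q : R) ^ ((orthogonalTwistExp (μ ∘ π) - orthogonalTwistExp μ) / 2).toNat * f.coeff μ}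
  add_mem' {f g} hf hg := by
    refine ⟨fun μ hμ => ?_, fun π hπ μ hle => ?_⟩
    · rw [AddMonoidAlgebra.coeff_add, Finsupp.add_apply, hf.1 μ hμ, hg.1 μ hμ, add_zero]
    · rw [AddMonoidAlgebra.coeff_add, Finsupp.add_apply, Finsupp.add_apply, hf.2 π hπ μ hle, hg.2 π hπ μ hle, mul_add]
  zero_mem' := ⟨fun μ _ => by rw [AddMonoidAlgebra.coeff_zero, Finsupp.zero_apply],
    fun π _ μ _ => by rw [AddMonoidAlgebra.coeff_zero, Finsupp.zero_apply, Finsupp.zero_apply, mul_zero]⟩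
  smul_mem' c {f} hf := by
    refine ⟨fun μ hμ => ?_, fun π hπ μ hle => ?_⟩
    · rw [AddMonoidAlgebra.coeff_smul, Finsupp.smul_apply, hf.1 μ hμ, smul_zero]
    · rw [AddMonoidAlgebra.coeff_smul, Finsupp.smul_apply, Finsupp.smul_apply, hf.2 π hπ μ hle, smul_eq_mul, smul_eq_mul,
        mul_left_comm]

/-- Membership in `𝒯^{O}_R(q)`. [cite: TreumannVenkatesh2016, §7.2] -/
theorem mem_orthogonalTwistedSatakeTarget_iff (q : ℕ) (f : AddMonoidAlgebra R (Fin N → ℤ)) :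
    f ∈ orthogonalTwistedSatakeTarget R N q ↔
      (∀ μ : Fin N → ℤ, (¬ ∀ i, μ (Fin.rev i) = -μ i) → f.coeff μ = 0) ∧
        ∀ π : Equiv.Perm (Fin N), (∀ i, π (Fin.rev i) = Fin.rev (π i)) → ∀ μ : Fin N → ℤ,
          orthogonalTwistExp μ ≤ orthogonalTwistExp (μ ∘ π) →
            f.coeff (μ ∘ π) = (q : R) ^ ((orthogonalTwistExp (μ ∘ π) - orthogonalTwistExp μ) / 2).toNat * f.coeff μ :=
  Iff.rfl

/-- The support of `f ∈ 𝒯^{O}_R` is stable under the `Λ`-non-increasing `W`-moves. [cite: TreumannVenkatesh2016, §7.2] -/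
theorem coeff_ne_zero_comp_of_mem_orthogonalTwisted {q : ℕ} {f : AddMonoidAlgebra R (Fin N → ℤ)}
    (hf : f ∈ orthogonalTwistedSatakeTarget R N q) {μ : Fin N → ℤ} (hμ : f.coeff μ ≠ 0) {π : Equiv.Perm (Fin N)}
    (hπ : ∀ i, π (Fin.rev i) = Fin.rev (π i)) (hle : orthogonalTwistExp (μ ∘ π) ≤ orthogonalTwistExp μ) : f.coeff (μ ∘ π) ≠ 0 := by
  intro h0
  have h1 := hf.2 π⁻¹ (perm_inv_rev hπ) (μ ∘ π)
  rw [Function.comp_assoc, ← Equiv.Perm.coe_mul, mul_inv_cancel, Equiv.Perm.coe_one, Function.comp_id] at h1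
  exact hμ (by rw [h1 hle, h0, mul_zero])

end Twisted

variable {K : Type*} [Field K] [Valued K ℤᵐ⁰] {ϖ : K}

namespace UnramifiedLocalConjDatum

variable [Finite 𝓀[K]]
  [IsHeckeTriple (⊤ : Submonoid (unitaryGroupOfForm (RingHom.id K) ((StdForm.antidiagonal N).over K)))
    (unitaryInt (RingHom.id K) ((StdForm.antidiagonal N).over K)) (unitaryInt (RingHom.id K) ((StdForm.antidiagonal N).over K))]

/-! ## §3 The coset counts of `O_N(J₀)` transform by powers of `q` -/

/-- **`n_g(μ∘π) = q^{⌊(Λ(μ∘π)-Λ(μ))/2⌋} · n_g(μ)`** for `n_g(μ) = #{γ ⊆ K₀gK₀ : a(γ) = μ}`, every `g ∈ O_N(J₀)`, every `π ∈ C_{S_N}(rev)` and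
every `μ` with `Λ(μ) ≤ Λ(μ∘π)` — an identity of NATURAL NUMBERS, read off from the `W`-invariance of the `ℂ`-valued transforms
`𝒮_{u^{-Λ}}(T_g)` for BOTH square roots `u = ±√q` (g49-#2); when the exponent difference is odd the two identities force
`n_g(μ∘π) = n_g(μ) = 0`. [cite: TreumannVenkatesh2016, §7.2] [cite: HenniartVigneras2013, §7.12 Lemma 2] -/
theorem card_filter_iwasawaExp_comp_perm_eq_orthogonal (hd : UnramifiedLocalConjDatum (RingHom.id K) ϖ)
    (g : unitaryGroupOfForm (RingHom.id K) ((StdForm.antidiagonal N).over K)) {π : Equiv.Perm (Fin N)}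
    (hπ : ∀ i, π (Fin.rev i) = Fin.rev (π i)) (μ : Fin N → ℤ) (hle : orthogonalTwistExp μ ≤ orthogonalTwistExp (μ ∘ π))
    [DecidablePred fun α : unitaryGroupOfForm (RingHom.id K) ((StdForm.antidiagonal N).over K) ⧸
        unitaryInt (RingHom.id K) ((StdForm.antidiagonal N).over K) => hd.iwasawaExp α.out = μ ∘ π]
    [DecidablePred fun α : unitaryGroupOfForm (RingHom.id K) ((StdForm.antidiagonal N).over K) ⧸
        unitaryInt (RingHom.id K) ((StdForm.antidiagonal N).over K) => hd.iwasawaExp α.out = μ] :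
    ((finite_orbit_quotient (unitaryInt (RingHom.id K) ((StdForm.antidiagonal N).over K)) g).toFinset.filter
        fun α => hd.iwasawaExp α.out = μ ∘ π).card =
      Nat.card 𝓀[K] ^ ((orthogonalTwistExp (μ ∘ π) - orthogonalTwistExp μ) / 2).toNat *
        ((finite_orbit_quotient (unitaryInt (RingHom.id K) ((StdForm.antidiagonal N).over K)) g).toFinset.filter
          fun α => hd.iwasawaExp α.out = μ).card := by
  set q := Nat.card 𝓀[K] with hq
  have hq0 : q ≠ 0 := Nat.card_pos.ne'
  set u : ℂˣ := Units.mk0 (residueCardSqrt K) residueCardSqrt_ne_zero with hu_def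
  have hu : (u : ℂ) ^ 2 = (q : ℂ) := by rw [hu_def, Units.val_mk0, residueCardSqrt_sq]
  have hu' : ((-u : ℂˣ) : ℂ) ^ 2 = (q : ℂ) := by rw [Units.val_neg, neg_sq, hu]
  obtain ⟨w, hw⟩ := exists_weight_units_zpow_neg_satakeTwistExp_sub_headSum (N := N) (R := ℂ) u
  obtain ⟨w', hw'⟩ := exists_weight_units_zpow_neg_satakeTwistExp_sub_headSum (N := N) (R := ℂ) (-u)
  have key := hd.coeff_satakeTransform_comp_perm_of_units_orthogonal' u hu N w hw
    (heckeAlgebra.doubleCosetOperator (unitaryInt (RingHom.id K) ((StdForm.antidiagonal N).over K)) g) π hπ μ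
  have key' := hd.coeff_satakeTransform_comp_perm_of_units_orthogonal' (-u) hu' N w' hw'
    (heckeAlgebra.doubleCosetOperator (unitaryInt (RingHom.id K) ((StdForm.antidiagonal N).over K)) g) π hπ μ
  rw [(hd.isIwasawaExponent (N := N)).coeff_satakeTransform_doubleCosetOperator w g (μ ∘ π),
    (hd.isIwasawaExponent (N := N)).coeff_satakeTransform_doubleCosetOperator w g μ, hw, hw] at key
  rw [(hd.isIwasawaExponent (N := N)).coeff_satakeTransform_doubleCosetOperator w' g (μ ∘ π),
    (hd.isIwasawaExponent (N := N)).coeff_satakeTransform_doubleCosetOperator w' g μ, hw', hw'] at key'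
  set A := ((finite_orbit_quotient (unitaryInt (RingHom.id K) ((StdForm.antidiagonal N).over K)) g).toFinset.filter
    fun α => hd.iwasawaExp α.out = μ ∘ π).card
  set B := ((finite_orbit_quotient (unitaryInt (RingHom.id K) ((StdForm.antidiagonal N).over K)) g).toFinset.filter
    fun α => hd.iwasawaExp α.out = μ).card
  rw [← orthogonalTwistExp_eq, ← orthogonalTwistExp_eq] at key key'
  set D := orthogonalTwistExp (μ ∘ π) - orthogonalTwistExp μ with hD
  have hD_eq : ((D.toNat : ℕ) : ℤ) = D := Int.toNat_of_nonneg (by omega)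
  -- `A · v^{-Λ₁} = B · v^{-Λ₀}` ⇒ `A = B · v^{D}` for `v = u` and `v = -u`
  have h1 : ∀ (v : ℂˣ), (A : ℂ) * ((v ^ (-orthogonalTwistExp (μ ∘ π)) : ℂˣ) : ℂ) =
      (B : ℂ) * ((v ^ (-orthogonalTwistExp μ) : ℂˣ) : ℂ) → (A : ℂ) = (B : ℂ) * ((v ^ D.toNat : ℂˣ) : ℂ) := by
    intro v hv
    have e : (A : ℂ) = (A : ℂ) * ((v ^ (-orthogonalTwistExp (μ ∘ π)) : ℂˣ) : ℂ) * ((v ^ orthogonalTwistExp (μ ∘ π) : ℂˣ) : ℂ) := by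
      rw [mul_assoc, ← Units.val_mul, ← zpow_add, neg_add_cancel, zpow_zero, Units.val_one, mul_one]
    rw [e, hv, mul_assoc, ← Units.val_mul, ← zpow_add, ← zpow_natCast, hD_eq]
    congr 3
    ring
  have hA := h1 u key
  have hA' := h1 (-u) key'
  rcases Nat.even_or_odd D.toNat with ⟨k, hk⟩ | ⟨k, hk⟩
  · -- even exponent: `u^{2k} = q^k`
    have hpow : ((u ^ D.toNat : ℂˣ) : ℂ) = (q : ℂ) ^ k := by
      rw [hk, ← two_mul, Units.val_pow_eq_pow_val, pow_mul, hu]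
    have hdiv : (D / 2).toNat = k := by omega
    rw [hdiv]
    rw [hpow] at hA
    exact Nat.cast_injective (R := ℂ) (by rw [hA]; push_cast; ring)
  · -- odd exponent: the two identities force `A = B = 0`
    have e1 : ((u ^ D.toNat : ℂˣ) : ℂ) = (q : ℂ) ^ k * (u : ℂ) := by
      rw [hk, Units.val_pow_eq_pow_val, pow_succ, pow_mul, hu]
    have e2 : (((-u) ^ D.toNat : ℂˣ) : ℂ) = -((q : ℂ) ^ k * (u : ℂ)) := by
      rw [hk, Units.val_pow_eq_pow_val, Units.val_neg, pow_succ, pow_mul, neg_sq, hu]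
      ring
    rw [e1] at hA
    rw [e2] at hA'
    have h2 : (2 : ℂ) * ((B : ℂ) * ((q : ℂ) ^ k * (u : ℂ))) = 0 := by linear_combination hA' - hA
    have hB : (B : ℂ) = 0 := by
      rcases mul_eq_zero.1 h2 with h | h
      · exact absurd h two_ne_zero
      rcases mul_eq_zero.1 h with h | h
      · exact h
      · exact absurd h (mul_ne_zero (pow_ne_zero _ (Nat.cast_ne_zero.2 hq0)) u.ne_zero)
    have hA0 : (A : ℂ) = 0 := by rw [hA, hB, zero_mul]
    have hA'' : A = 0 := by exact_mod_cast hA0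
    have hB'' : B = 0 := by exact_mod_cast hB
    rw [hA'', hB'', mul_zero]

/-! ## §4 `𝒮_1(ℋ_R) ⊆ 𝒯^{O}_R` -/

/-- **`𝒮_1(T) ∈ 𝒯^{O}_R` for every `T ∈ ℋ(O_N(J₀), K₀; R)` and every commutative ring `R`**: the counting transform of a double-coset
operator has the natural-number coefficients `n_g(μ)`, which satisfy the twisted relations by §3, and the double-coset operators span
`ℋ_R`. [cite: TreumannVenkatesh2016, §7.2] [cite: HenniartVigneras2013, §7.13] -/
theorem satakeTransform_one_mem_orthogonalTwistedSatakeTarget (hd : UnramifiedLocalConjDatum (RingHom.id K) ϖ)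
    (T : heckeAlgebra R (unitaryGroupOfForm (RingHom.id K) ((StdForm.antidiagonal N).over K))
      (unitaryInt (RingHom.id K) ((StdForm.antidiagonal N).over K))) :
    (hd.isIwasawaExponent (N := N)).satakeTransform 1 T ∈ orthogonalTwistedSatakeTarget R N (Nat.card 𝓀[K]) := by
  classical
  have hsub : Set.range (heckeAlgebra.doubleCosetOperator (k := R) (unitaryInt (RingHom.id K) ((StdForm.antidiagonal N).over K))) ⊆
      (orthogonalTwistedSatakeTarget R N (Nat.card 𝓀[K])).comap ((hd.isIwasawaExponent (N := N)).satakeTransform 1).toLinearMap := by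
    rintro _ ⟨g, rfl⟩
    refine ⟨fun μ hμ => hd.coeff_satakeTransform_eq_zero_of_not_rev 1 _ hμ, fun π hπ μ hle => ?_⟩
    change ((hd.isIwasawaExponent (N := N)).satakeTransform 1 (heckeAlgebra.doubleCosetOperator _ g)).coeff (μ ∘ π) =
      _ * ((hd.isIwasawaExponent (N := N)).satakeTransform 1 (heckeAlgebra.doubleCosetOperator _ g)).coeff μ
    rw [(hd.isIwasawaExponent (N := N)).coeff_satakeTransform_doubleCosetOperator 1 g (μ ∘ π),
      (hd.isIwasawaExponent (N := N)).coeff_satakeTransform_doubleCosetOperator 1 g μ, MonoidHom.one_apply, MonoidHom.one_apply,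
      mul_one, mul_one, hd.card_filter_iwasawaExp_comp_perm_eq_orthogonal g hπ μ hle, Nat.cast_mul, Nat.cast_pow]
  exact (Submodule.span_le.2 hsub)
    (heckeAlgebra.mem_span_range_doubleCosetOperator (unitaryInt (RingHom.id K) ((StdForm.antidiagonal N).over K)) T)

/-! ## §5 `𝒯^{O}_R ⊆ 𝒮_1(ℋ_R)`: triangular induction from the antidominant end -/

/-- **SURJECTIVITY OF THE COUNTING TRANSFORM OF `O_N(J₀)` ONTO `𝒯^{O}_R`, EVERY COMMUTATIVE RING `R`**: every `f ∈ 𝒯^{O}_R` is `𝒮_1(T)`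
for some `T ∈ ℋ(O_N(J₀), K₀; R)` — triangular induction from the antidominant end as in g49-#6 (the head-sum-minimal `c ∈ supp f` is
antidominant by §1–§2, and `𝒮_1(T_c)` has coefficient `1` at `x^c`). [cite: TreumannVenkatesh2016, §7.2 Thm. (i)]
[cite: HenniartVigneras2013, §7.14] [cite: CartierCorvallis1979, §IV Thm. 4.1 and its proof (c)] [cite: BruhatTits1972, (4.4.4) (ii)] -/
theorem exists_satakeTransform_one_eq_of_mem_orthogonalTwisted (hd : UnramifiedLocalConjDatum (RingHom.id K) ϖ)
    (f : AddMonoidAlgebra R (Fin N → ℤ)) (hf : f ∈ orthogonalTwistedSatakeTarget R N (Nat.card 𝓀[K])) :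
    ∃ T : heckeAlgebra R (unitaryGroupOfForm (RingHom.id K) ((StdForm.antidiagonal N).over K))
        (unitaryInt (RingHom.id K) ((StdForm.antidiagonal N).over K)),
      (hd.isIwasawaExponent (N := N)).satakeTransform 1 T = f := by
  classical
  suffices H : ∀ (m : ℕ) (f : AddMonoidAlgebra R (Fin N → ℤ)), f ∈ orthogonalTwistedSatakeTarget R N (Nat.card 𝓀[K]) →
      (finite_upperAntidominantSet f).toFinset.card = m →
      ∃ T : heckeAlgebra R (unitaryGroupOfForm (RingHom.id K) ((StdForm.antidiagonal N).over K))
          (unitaryInt (RingHom.id K) ((StdForm.antidiagonal N).over K)),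
        (hd.isIwasawaExponent (N := N)).satakeTransform 1 T = f from H _ f hf rfl
  intro m
  induction m using Nat.strong_induction_on with
  | _ m ih =>
  intro f hf hm
  by_cases h0 : f = 0
  · exact ⟨0, by rw [h0, map_zero]⟩
  obtain ⟨hsupp, hrel⟩ := (mem_orthogonalTwistedSatakeTarget_iff _ f).1 hf
  -- the head-sum-minimal exponent `c ∈ supp f` is antidominant
  have hSne : f.coeff.support.Nonempty := by
    rw [Finsupp.support_nonempty_iff, ne_eq, AddMonoidAlgebra.coeff_eq_zero]
    exact h0
  obtain ⟨c, hcS, hmin⟩ := f.coeff.support.exists_min_image (fun μ => toLex (headSumVec μ)) hSne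
  have hcS' : f.coeff c ≠ 0 := Finsupp.mem_support_iff.1 hcS
  have hanti : ∀ μ ∈ f.coeff.support, ∀ i, μ (Fin.rev i) = -μ i := fun μ hμ => by
    by_contra h
    exact Finsupp.mem_support_iff.1 hμ (hsupp μ h)
  have hstab : ∀ μ ∈ f.coeff.support, ∀ π : Equiv.Perm (Fin N), (∀ i, π (Fin.rev i) = Fin.rev (π i)) →
      orthogonalTwistExp (μ ∘ π) ≤ orthogonalTwistExp μ → μ ∘ π ∈ f.coeff.support := fun μ hμ π hπ hle => by
    rw [Finsupp.mem_support_iff] at hμ ⊢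
    exact coeff_ne_zero_comp_of_mem_orthogonalTwisted hf hμ hπ hle
  have hmono : Monotone c := monotone_of_isMinOn_headSumVec_orthogonal hstab hanti hcS hmin
  have hc : Monotone c ∧ ∀ i, c (Fin.rev i) = -c i := ⟨hmono, hanti c hcS⟩
  -- the Cartan operator `T_c` and its counting transform `F = x^c + higher terms`
  set Tc : heckeAlgebra R (unitaryGroupOfForm (RingHom.id K) ((StdForm.antidiagonal N).over K))
      (unitaryInt (RingHom.id K) ((StdForm.antidiagonal N).over K)) :=
    heckeAlgebra.doubleCosetOperator (unitaryInt (RingHom.id K) ((StdForm.antidiagonal N).over K))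
      (⟨zpowDiagGL (uniformizer_ne_zero hd.vϖ) c, zpowDiagGL_mem_unitaryGroupOfForm hd.σϖ _ hc.2⟩ :
        unitaryGroupOfForm (RingHom.id K) ((StdForm.antidiagonal N).over K)) with hTc
  set F := (hd.isIwasawaExponent (N := N)).satakeTransform 1 Tc with hFdef
  have hF1 : F.coeff c = 1 := by
    rw [hFdef, hTc, hd.coeff_satakeTransform_doubleCosetOperator_zpowDiagGL_monotone_unitary 1 hc rfl, MonoidHom.one_apply]
  have htri : ∀ μ, F.coeff μ ≠ 0 → ∀ r, headSum c r ≤ headSum μ r := fun μ hμ r =>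
    hd.headSum_le_of_coeff_satakeTransform_doubleCosetOperator_monotone_ne_zero 1 hc hμ r
  have hF : F ∈ orthogonalTwistedSatakeTarget R N (Nat.card 𝓀[K]) := hd.satakeTransform_one_mem_orthogonalTwistedSatakeTarget Tc
  -- `g = f - f_c F`
  set k : R := f.coeff c with hk
  set g := f - k • F with hgdef
  have hg : g ∈ orthogonalTwistedSatakeTarget R N (Nat.card 𝓀[K]) := Submodule.sub_mem _ hf (Submodule.smul_mem _ k hF)
  have hgcoeff : ∀ μ, g.coeff μ = f.coeff μ - k * F.coeff μ := fun μ => by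
    rw [hgdef, AddMonoidAlgebra.coeff_sub, AddMonoidAlgebra.coeff_smul, Finsupp.sub_apply, Finsupp.smul_apply, smul_eq_mul]
  have hgc : g.coeff c = 0 := by rw [hgcoeff, hF1, mul_one, sub_self]
  have hgsupp : ∀ μ, g.coeff μ ≠ 0 → f.coeff μ ≠ 0 ∨ F.coeff μ ≠ 0 := fun μ h => by
    by_contra h'
    rw [not_or, not_ne_iff, not_ne_iff] at h'
    exact h (by rw [hgcoeff, h'.1, h'.2, mul_zero, sub_zero])
  -- `U'(g) ⊊ U'(f)`
  have hsub : upperAntidominantSet g ⊆ upperAntidominantSet f := by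
    rintro la ⟨h1, h2, b, hb, hbm, hle⟩
    rcases hgsupp b hb with hbf | hbF
    · exact ⟨h1, h2, b, hbf, hbm, hle⟩
    · exact ⟨h1, h2, c, hcS', hmono, fun r => (htri b hbF r).trans (hle r)⟩
  have hcU : c ∈ upperAntidominantSet f := ⟨hmono, hc.2, c, hcS', hmono, fun _ => le_rfl⟩
  have hcU' : c ∉ upperAntidominantSet g := by
    rintro ⟨-, -, b, hb, -, hle⟩
    have hbc : b = c := by
      rcases hgsupp b hb with hbf | hbF
      · exact eq_of_headSum_le_of_toLex_le hle (hmin b (Finsupp.mem_support_iff.2 hbf))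
      · exact eq_of_headSum_le_antisymm hle (htri b hbF)
    rw [hbc] at hb
    exact hb hgc
  have hlt : (finite_upperAntidominantSet g).toFinset.card < (finite_upperAntidominantSet f).toFinset.card :=
    Finset.card_lt_card (Set.Finite.toFinset_ssubset_toFinset.2 ((Set.ssubset_iff_of_subset hsub).2 ⟨c, hcU, hcU'⟩))
  obtain ⟨T', hT'⟩ := ih _ (hm ▸ hlt) g hg rfl
  refine ⟨T' + k • Tc, ?_⟩
  rw [map_add, map_smul, hT', hgdef, sub_add_cancel]

/-- **`range 𝒮_1 = 𝒯^{O}_R`**: over every commutative ring `R`, the image of the counting Satake transform of `ℋ(O_N(J₀), K₀; R)` is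
exactly the submodule of orthogonal twisted Weyl invariants. [cite: TreumannVenkatesh2016, §7.2 Thm. (i)]
[cite: HenniartVigneras2013, §7.13 Cor., §7.15 Thm.] -/
theorem range_satakeTransform_one_eq_orthogonalTwistedSatakeTarget (hd : UnramifiedLocalConjDatum (RingHom.id K) ϖ) :
    LinearMap.range ((hd.isIwasawaExponent (N := N)).satakeTransform (1 : Multiplicative (Fin N → ℤ) →* R)).toLinearMap =
      orthogonalTwistedSatakeTarget R N (Nat.card 𝓀[K]) := by
  refine le_antisymm ?_ fun f hf => ?_
  · rintro _ ⟨T, rfl⟩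
    exact hd.satakeTransform_one_mem_orthogonalTwistedSatakeTarget T
  · obtain ⟨T, hT⟩ := hd.exists_satakeTransform_one_eq_of_mem_orthogonalTwisted f hf
    exact ⟨T, hT⟩

/-- The range of the counting transform as a SUBALGEBRA of `R[ℤ^N]` has underlying submodule `𝒯^{O}_R`.
[cite: TreumannVenkatesh2016, §7.2 Thm. (i)] -/
theorem toSubmodule_range_satakeTransform_one_eq_orthogonalTwistedSatakeTarget (hd : UnramifiedLocalConjDatum (RingHom.id K) ϖ) :
    Subalgebra.toSubmodule ((hd.isIwasawaExponent (N := N)).satakeTransform (1 : Multiplicative (Fin N → ℤ) →* R)).range =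
      orthogonalTwistedSatakeTarget R N (Nat.card 𝓀[K]) := by
  rw [← hd.range_satakeTransform_one_eq_orthogonalTwistedSatakeTarget]
  ext f
  rw [Subalgebra.mem_toSubmodule, AlgHom.mem_range, LinearMap.mem_range]
  rfl

/-- **`𝒯^{O}_R` is closed under multiplication** (it is the image of an algebra homomorphism). [cite: TreumannVenkatesh2016, §7.2] -/
theorem mul_mem_orthogonalTwistedSatakeTarget (hd : UnramifiedLocalConjDatum (RingHom.id K) ϖ) {f g : AddMonoidAlgebra R (Fin N → ℤ)}
    (hf : f ∈ orthogonalTwistedSatakeTarget R N (Nat.card 𝓀[K])) (hg : g ∈ orthogonalTwistedSatakeTarget R N (Nat.card 𝓀[K])) :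
    f * g ∈ orthogonalTwistedSatakeTarget R N (Nat.card 𝓀[K]) := by
  obtain ⟨S, rfl⟩ := hd.exists_satakeTransform_one_eq_of_mem_orthogonalTwisted f hf
  obtain ⟨T, rfl⟩ := hd.exists_satakeTransform_one_eq_of_mem_orthogonalTwisted g hg
  rw [← map_mul]
  exact hd.satakeTransform_one_mem_orthogonalTwistedSatakeTarget (S * T)

/-- **THE COUNTING SATAKE ISOMORPHISM `ℋ(O_N(J₀), K₀; R) ≃ₗ[R] 𝒯^{O}_R` OVER EVERY COMMUTATIVE RING `R`** (multiplicative as the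
restriction of the algebra homomorphism `𝒮_1`; injective by `satakeTransform_injective_of_commRing`, onto by the triangular induction).
[cite: TreumannVenkatesh2016, §7.2 Thm. (i)] [cite: HenniartVigneras2013, §7.15 Thm.] [cite: CartierCorvallis1979, §IV Thm. 4.1] -/
def countingSatakeLinearEquivOrthogonal (hd : UnramifiedLocalConjDatum (RingHom.id K) ϖ) :
    heckeAlgebra R (unitaryGroupOfForm (RingHom.id K) ((StdForm.antidiagonal N).over K))
        (unitaryInt (RingHom.id K) ((StdForm.antidiagonal N).over K)) ≃ₗ[R]
      orthogonalTwistedSatakeTarget R N (Nat.card 𝓀[K]) :=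
  LinearEquiv.ofBijective
    (((hd.isIwasawaExponent (N := N)).satakeTransform (1 : Multiplicative (Fin N → ℤ) →* R)).toLinearMap.codRestrict
      (orthogonalTwistedSatakeTarget R N (Nat.card 𝓀[K])) fun T => hd.satakeTransform_one_mem_orthogonalTwistedSatakeTarget T)
    ⟨fun T T' h => hd.satakeTransform_injective_of_commRing 1 (congrArg Subtype.val h),
      fun f => by
        obtain ⟨T, hT⟩ := hd.exists_satakeTransform_one_eq_of_mem_orthogonalTwisted f.1 f.2
        exact ⟨T, Subtype.ext hT⟩⟩

/-- The orthogonal counting Satake isomorphism is the counting transform `𝒮_1`. [cite: TreumannVenkatesh2016, §7.2] -/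
@[simp] theorem countingSatakeLinearEquivOrthogonal_apply (hd : UnramifiedLocalConjDatum (RingHom.id K) ϖ)
    (T : heckeAlgebra R (unitaryGroupOfForm (RingHom.id K) ((StdForm.antidiagonal N).over K))
      (unitaryInt (RingHom.id K) ((StdForm.antidiagonal N).over K))) :
    ((hd.countingSatakeLinearEquivOrthogonal T : orthogonalTwistedSatakeTarget R N (Nat.card 𝓀[K])) :
        AddMonoidAlgebra R (Fin N → ℤ)) = (hd.isIwasawaExponent (N := N)).satakeTransform 1 T := rfl

end UnramifiedLocalConjDatum

end Literature.NumberTheory.Automorphic.HermitianLattice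

end
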